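import Summits.Ventures.LatticeQCDFlow.Scaling.HubProposalLaw
import Summits.Ventures.LatticeQCDFlow.Scaling.SwapGraphDilution

/-!
HONEST FRAMING: exact (Metropolis-corrected) sampling algorithms for lattice gauge theory; figures
of merit are autocorrelation/cost numbers at stated couplings and volumes; no continuum-physics
claim.

# SlowColdReplicas — COLD REPLICAS THAT TUNNEL ON THEIR OWN ADD EXACTLY THEIR OWN EXIT FLOW: FOR EVERY SWAP GRAPH,
# SECTOR-PRESERVING MAPS AND UPDATE ALLOCATION, `Gap ≤ (t·(h/m)·min{μ_0(A),μ_0(Aᶜ)} + (1−t)·Σ_{k≠0} w_kQ_k(A,Aᶜ))/(Kv)`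
# AND, REPLICA BY REPLICA, `Gap ≤ (t·deg(k)/(2m) + (1−t)·w_k·Q_k(A,Aᶜ))/(μ_k(A)μ_k(Aᶜ))` — THE EXCHANGE CONTRIBUTES
# ONLY ITS DILUTED PROPOSAL FREQUENCY, WHATEVER THE COLD REPLICAS DO (lean-2 GEN-23, ours)

Venture-side (OURS).  Cell `lqcd-flow` (pub-lqcd), unit `pub-lqcd-lean-2-g23`, 2026-08-26.  Chapter K, file 12: the
ceilings of `Scaling/SwapGraphDilution` (K1) and `Scaling/HubProposalLaw` (K2) WITHOUT the idleness hypothesis on the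
cold replicas.  Scheme `P = t·ptGraphSwap μ e φ + (1−t)·prodKernel w M` on an edge list `e` of `m` entries (distinct
endpoints), sector-preserving maps `φ_r(A) = A`, any allocation `w`; `Q_k(A,Aᶜ)` the exit flow of replica `k`'s own
update from `A`; `h` the entries at the hot level, `deg(k)` the entries at level `k`.

## What is proved

* §1 **`slowCold_handover_spectralGap_le`** — `μ_k(A)μ_k(Aᶜ) ≥ v > 0` for `k ≠ 0`, `K, m ≥ 1`:
  **`Gap(P) ≤ (t·(h/m)·min{μ_0(A), μ_0(Aᶜ)} + (1−t)·Σ_{k≠0} w_k·Q_k(A,Aᶜ))/(K·v)`**.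
* §2 **`slowCold_replica_spectralGap_le`** — for every level `k` with `μ_k(A)μ_k(Aᶜ) > 0`:
  **`Gap(P) ≤ (t·deg(k)/(2m) + (1−t)·w_k·Q_k(A,Aᶜ))/(μ_k(A)μ_k(Aᶜ))`**.
* §3 **`slowCold_replica_spectralGap_le_of_dominated`** — if replica `k`'s own sector crossings are rarer than its
  proposals, `(1−t)·w_k·Q_k(A,Aᶜ) ≤ t·deg(k)/(2m)`, then `Gap(P) ≤ t·deg(k)/(m·μ_k(A)μ_k(Aᶜ))`: the idle ceiling of K2 up
  to a factor `2`.

Reading (no numerics implied): the exchange never does more for a cold replica than offer it the hot configuration at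
its diluted proposal frequency; a cold replica's own barrier crossings enter additively, at their own (metastable,
hence small) rate, so the conclusions of K1/K2 degrade gracefully from "idle" to "slow".  NOT CLAIMED: floors using the
cold replicas' own tunnelling; continuous spaces; anything measured.  Literature grade (cell rule): OWN COMPOSITION
(H1 + K1 + K2); nothing cited as a fact; no new bib keys.
-/

noncomputable section

open Finset Function
open Literature.Probability.MarkovChains

namespace Summit.Ventures.LatticeQCDFlow.Scaling

variable {S : Type*} [Fintype S] [DecidableEq S] {K m : ℕ} {μ : Fin (K + 1) → S → ℝ}
  {M : Fin (K + 1) → S → S → ℝ} {w : Fin (K + 1) → ℝ} {t : ℝ} {e : Fin m → Fin (K + 1) × Fin (K + 1)}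
  {φ : Fin m → Equiv.Perm S}

/-! ## §1 The diluted handover ceiling with slowly tunnelling cold replicas -/

/-- **THE DILUTED HANDOVER CEILING, COLD REPLICAS NOT IDLE:** `0 ≤ t ≤ 1`, `w` a probability vector, sector-preserving
maps, `μ_k(A)μ_k(Aᶜ) ≥ v > 0` for `k ≠ 0`, `K, m ≥ 1`, `|S| ≥ 2`:
**`Gap(P) ≤ (t·(h/m)·min{μ_0(A), μ_0(Aᶜ)} + (1−t)·Σ_{k≠0} w_k·Q_k(A,Aᶜ))/(K·v)`**. [ours] -/
theorem slowCold_handover_spectralGap_le [Nontrivial S] (hK : 1 ≤ K) (hm : 1 ≤ m) (he : ∀ r, (e r).1 ≠ (e r).2)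
    (hμ : ∀ k x, 0 < μ k x) (hμ1 : ∀ k, ∑ u, μ k u = 1) (hM : ∀ k, IsRowStochastic (M k))
    (hMrev : ∀ k, DetailedBalance (μ k) (M k)) (hw0 : ∀ k, 0 ≤ w k) (hw1 : ∑ k, w k = 1) (ht0 : 0 ≤ t)
    (ht1 : t ≤ 1) {A : Finset S} (hφA : ∀ r u, φ r u ∈ A ↔ u ∈ A) {v : ℝ} (hvpos : 0 < v)
    (hv : ∀ k : Fin (K + 1), k ≠ 0 → v ≤ (∑ u ∈ A, μ k u) * ∑ u ∈ Aᶜ, μ k u) :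
    spectralGap (tensorFun μ) (fun x y : Fin (K + 1) → S => t * ptGraphSwap μ e φ x y + (1 - t) * prodKernel w M x y)
      ≤ (t * (((univ.filter fun r : Fin m => (e r).1 = 0 ∨ (e r).2 = 0).card : ℝ) / m
              * min (∑ u ∈ A, μ 0 u) (∑ u ∈ Aᶜ, μ 0 u))
          + (1 - t) * ∑ k, w k * (if k = 0 then (0 : ℝ) else edgeMeasure (μ k) (M k) A Aᶜ)) / (K * v) := by
  have hKpos : (0 : ℝ) < K := Nat.cast_pos.mpr (by omega)
  have hmpos : (0 : ℝ) < m := Nat.cast_pos.mpr (by omega)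
  have hQ := ptGraphSwap_isRowStochastic (e := e) (φ := φ) hμ
  have hQrev := ptGraphSwap_detailedBalance (e := e) (φ := φ) hμ
  have hQA := ptGraphSwap_sectorCount_eq (μ := μ) he hμ hφA
  have hVge := coldSectorMass_ge (μ := μ) (A := A) hv
  have h := handover_spectralGap_le (w := w) hμ hμ1 hM hMrev hw0 hw1 ht0 ht1 hQ hQrev hQA
    (lt_of_lt_of_le (mul_pos hKpos hvpos) hVge)
  set η := edgeMeasure (tensorFun μ) (ptGraphSwap μ e φ) (univ.filter (fun x : Fin (K + 1) → S => x 0 ∈ A))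
    (univ.filter (fun x : Fin (K + 1) → S => x 0 ∈ A))ᶜ with hη
  set U := ∑ k, w k * (if k = 0 then (0 : ℝ) else edgeMeasure (μ k) (M k) A Aᶜ) with hU
  have hηle : η ≤ ((univ.filter fun r : Fin m => (e r).1 = 0 ∨ (e r).2 = 0).card : ℝ) / m
      * min (∑ u ∈ A, μ 0 u) (∑ u ∈ Aᶜ, μ 0 u) := by
    rw [mul_min_of_nonneg _ _ (by positivity)]
    exact le_min (ptGraphSwap_handoverFlow_le hμ hμ1 A) (ptGraphSwap_handoverFlow_le_compl hμ hμ1 A)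
  have hU0 : 0 ≤ U := sum_nonneg fun k _ => mul_nonneg (hw0 k) (by
    split_ifs
    · exact le_rfl
    · exact edgeMeasure_nonneg (fun u => (hμ k u).le) (hM k).1 A Aᶜ)
  have hnum0 : 0 ≤ t * η + (1 - t) * U :=
    add_nonneg (mul_nonneg ht0 (edgeMeasure_nonneg (fun x => (tensorFun_pos hμ x).le) hQ.1 _ _))
      (mul_nonneg (by linarith) hU0)
  calc spectralGap (tensorFun μ) (fun x y : Fin (K + 1) → S =>
          t * ptGraphSwap μ e φ x y + (1 - t) * prodKernel w M x y)
      ≤ (t * η + (1 - t) * U) / ∑ k : Fin (K + 1), (if k = 0 then (0 : ℝ) else (∑ u ∈ A, μ k u) * ∑ u ∈ Aᶜ, μ k u) := h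
    _ ≤ (t * η + (1 - t) * U) / (K * v) := div_le_div_of_nonneg_left hnum0 (by positivity) hVge
    _ ≤ _ := div_le_div_of_nonneg_right (by nlinarith [mul_le_mul_of_nonneg_left hηle ht0]) (by positivity)

/-! ## §2 One slowly tunnelling replica -/

/-- **ONE COLD REPLICA, NOT IDLE:** for every level `k` with `μ_k(A)μ_k(Aᶜ) > 0`, sector-preserving maps, `m ≥ 1`,
`0 ≤ t ≤ 1`, `|S| ≥ 2`: **`Gap(P) ≤ (t·deg(k)/(2m) + (1−t)·w_k·Q_k(A,Aᶜ))/(μ_k(A)μ_k(Aᶜ))`**. [ours] -/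
theorem slowCold_replica_spectralGap_le [Nontrivial S] (hm : 1 ≤ m) (he : ∀ r, (e r).1 ≠ (e r).2)
    (hμ : ∀ k x, 0 < μ k x) (hμ1 : ∀ k, ∑ u, μ k u = 1) (hM : ∀ k, IsRowStochastic (M k))
    (hMrev : ∀ k, DetailedBalance (μ k) (M k)) (hw0 : ∀ k, 0 ≤ w k) (hw1 : ∑ k, w k = 1) (ht0 : 0 ≤ t)
    (ht1 : t ≤ 1) {A : Finset S} (hφA : ∀ r u, φ r u ∈ A ↔ u ∈ A) (k : Fin (K + 1))
    (hAk : 0 < (∑ u ∈ A, μ k u) * ∑ u ∈ Aᶜ, μ k u) :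
    spectralGap (tensorFun μ) (fun x y : Fin (K + 1) → S => t * ptGraphSwap μ e φ x y + (1 - t) * prodKernel w M x y)
      ≤ (t * (((univ.filter fun r : Fin m => (e r).1 = k ∨ (e r).2 = k).card : ℝ) / (2 * m))
          + (1 - t) * (w k * edgeMeasure (μ k) (M k) A Aᶜ)) / ((∑ u ∈ A, μ k u) * ∑ u ∈ Aᶜ, μ k u) := by
  have hmpos : (0 : ℝ) < m := Nat.cast_pos.mpr (by omega)
  set a : Fin (K + 1) → ℝ := fun i => if i = k then (1 : ℝ) else 0 with ha
  have hden : ∑ i, a i ^ 2 * ((∑ u ∈ A, μ i u) * ∑ u ∈ Aᶜ, μ i u) = (∑ u ∈ A, μ k u) * ∑ u ∈ Aᶜ, μ k u := by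
    simp_rw [ha, ite_pow, one_pow, zero_pow two_ne_zero, ite_mul, one_mul, zero_mul]
    rw [Finset.sum_ite_eq' univ k, if_pos (mem_univ _)]
  have hupd : ∑ i, w i * (a i ^ 2 * edgeMeasure (μ i) (M i) A Aᶜ) = w k * edgeMeasure (μ k) (M k) A Aᶜ := by
    simp_rw [ha, ite_pow, one_pow, zero_pow two_ne_zero, ite_mul, one_mul, zero_mul, mul_ite, mul_zero]
    rw [Finset.sum_ite_eq' univ k, if_pos (mem_univ _)]
  have hsw : ∑ r : Fin m, (a (e r).1 - a (e r).2) ^ 2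
        * ((∑ u ∈ A, μ (e r).1 u) * (∑ u ∈ Aᶜ, μ (e r).2 u) + (∑ u ∈ Aᶜ, μ (e r).1 u) * ∑ u ∈ A, μ (e r).2 u)
      ≤ ((univ.filter fun r : Fin m => (e r).1 = k ∨ (e r).2 = k).card : ℝ) := by
    have hpt : ∀ r : Fin m, (a (e r).1 - a (e r).2) ^ 2
        * ((∑ u ∈ A, μ (e r).1 u) * (∑ u ∈ Aᶜ, μ (e r).2 u) + (∑ u ∈ Aᶜ, μ (e r).1 u) * ∑ u ∈ A, μ (e r).2 u)
        ≤ if (e r).1 = k ∨ (e r).2 = k then (1 : ℝ) else 0 := by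
      intro r
      have hD := levelDisagreement_le_one μ (fun i u => (hμ i u).le) hμ1 A (e r).1 (e r).2
      have hD0 : 0 ≤ (∑ u ∈ A, μ (e r).1 u) * (∑ u ∈ Aᶜ, μ (e r).2 u)
          + (∑ u ∈ Aᶜ, μ (e r).1 u) * ∑ u ∈ A, μ (e r).2 u :=
        add_nonneg (mul_nonneg (sum_nonneg fun u _ => (hμ _ u).le) (sum_nonneg fun u _ => (hμ _ u).le))
          (mul_nonneg (sum_nonneg fun u _ => (hμ _ u).le) (sum_nonneg fun u _ => (hμ _ u).le))
      have hak : ∀ i, a i = if i = k then (1 : ℝ) else 0 := fun i => by rw [ha]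
      by_cases h1 : (e r).1 = k
      · have h2 : (e r).2 ≠ k := fun h2 => he r (h1.trans h2.symm)
        rw [if_pos (Or.inl h1), hak, hak, if_pos h1, if_neg h2]; nlinarith
      · by_cases h2 : (e r).2 = k
        · rw [if_pos (Or.inr h2), hak, hak, if_neg h1, if_pos h2]; nlinarith
        · rw [if_neg (not_or.mpr ⟨h1, h2⟩), hak, hak, if_neg h1, if_neg h2]; nlinarith
    refine (sum_le_sum fun r _ => hpt r).trans (le_of_eq ?_)
    rw [Finset.sum_boole]
  have h := weightedGraph_spectralGap_le_profile (t := t) (w := w) (M := M) (e := e) (φ := φ) hμ hμ1 hM hMrev hw0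
    hw1 ht0 ht1 he a hφA (hden ▸ hAk)
  rw [hden, hupd] at h
  refine h.trans (div_le_div_of_nonneg_right ?_ hAk.le)
  have := mul_le_mul_of_nonneg_left hsw ht0
  have e1 : t * (1 / (2 * m) * ∑ r : Fin m, (a (e r).1 - a (e r).2) ^ 2
        * ((∑ u ∈ A, μ (e r).1 u) * (∑ u ∈ Aᶜ, μ (e r).2 u) + (∑ u ∈ Aᶜ, μ (e r).1 u) * ∑ u ∈ A, μ (e r).2 u))
      = (1 / (2 * m)) * (t * ∑ r : Fin m, (a (e r).1 - a (e r).2) ^ 2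
        * ((∑ u ∈ A, μ (e r).1 u) * (∑ u ∈ Aᶜ, μ (e r).2 u) + (∑ u ∈ Aᶜ, μ (e r).1 u) * ∑ u ∈ A, μ (e r).2 u)) := by
    ring
  have e2 : t * (((univ.filter fun r : Fin m => (e r).1 = k ∨ (e r).2 = k).card : ℝ) / (2 * m))
      = (1 / (2 * m)) * (t * ((univ.filter fun r : Fin m => (e r).1 = k ∨ (e r).2 = k).card : ℝ)) := by ring
  rw [e1, e2]
  exact add_le_add (mul_le_mul_of_nonneg_left this (by positivity)) le_rfl

/-! ## §3 When the replica's own crossings are rarer than its proposals -/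

/-- **IDLE UP TO A FACTOR TWO:** if `(1−t)·w_k·Q_k(A,Aᶜ) ≤ t·deg(k)/(2m)` then
`Gap(P) ≤ t·deg(k)/(m·μ_k(A)μ_k(Aᶜ))`. [ours] -/
theorem slowCold_replica_spectralGap_le_of_dominated [Nontrivial S] (hm : 1 ≤ m) (he : ∀ r, (e r).1 ≠ (e r).2)
    (hμ : ∀ k x, 0 < μ k x) (hμ1 : ∀ k, ∑ u, μ k u = 1) (hM : ∀ k, IsRowStochastic (M k))
    (hMrev : ∀ k, DetailedBalance (μ k) (M k)) (hw0 : ∀ k, 0 ≤ w k) (hw1 : ∑ k, w k = 1) (ht0 : 0 ≤ t)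
    (ht1 : t ≤ 1) {A : Finset S} (hφA : ∀ r u, φ r u ∈ A ↔ u ∈ A) (k : Fin (K + 1))
    (hAk : 0 < (∑ u ∈ A, μ k u) * ∑ u ∈ Aᶜ, μ k u)
    (hslow : (1 - t) * (w k * edgeMeasure (μ k) (M k) A Aᶜ)
      ≤ t * (((univ.filter fun r : Fin m => (e r).1 = k ∨ (e r).2 = k).card : ℝ) / (2 * m))) :
    spectralGap (tensorFun μ) (fun x y : Fin (K + 1) → S => t * ptGraphSwap μ e φ x y + (1 - t) * prodKernel w M x y)
      ≤ t * ((univ.filter fun r : Fin m => (e r).1 = k ∨ (e r).2 = k).card : ℝ)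
          / (m * ((∑ u ∈ A, μ k u) * ∑ u ∈ Aᶜ, μ k u)) := by
  have hmpos : (0 : ℝ) < m := Nat.cast_pos.mpr (by omega)
  refine (slowCold_replica_spectralGap_le hm he hμ hμ1 hM hMrev hw0 hw1 ht0 ht1 hφA k hAk).trans ?_
  rw [div_le_div_iff₀ hAk (by positivity)]
  have hd : t * (((univ.filter fun r : Fin m => (e r).1 = k ∨ (e r).2 = k).card : ℝ) / (2 * m))
        + (1 - t) * (w k * edgeMeasure (μ k) (M k) A Aᶜ)
      ≤ t * ((univ.filter fun r : Fin m => (e r).1 = k ∨ (e r).2 = k).card : ℝ) / m := by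
    calc _ ≤ t * (((univ.filter fun r : Fin m => (e r).1 = k ∨ (e r).2 = k).card : ℝ) / (2 * m))
          + t * (((univ.filter fun r : Fin m => (e r).1 = k ∨ (e r).2 = k).card : ℝ) / (2 * m)) :=
          add_le_add le_rfl hslow
      _ = t * ((univ.filter fun r : Fin m => (e r).1 = k ∨ (e r).2 = k).card : ℝ) / m := by
          field_simp; ring
  calc (t * (((univ.filter fun r : Fin m => (e r).1 = k ∨ (e r).2 = k).card : ℝ) / (2 * m))
          + (1 - t) * (w k * edgeMeasure (μ k) (M k) A Aᶜ)) * (m * ((∑ u ∈ A, μ k u) * ∑ u ∈ Aᶜ, μ k u))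
      ≤ (t * ((univ.filter fun r : Fin m => (e r).1 = k ∨ (e r).2 = k).card : ℝ) / m)
          * (m * ((∑ u ∈ A, μ k u) * ∑ u ∈ Aᶜ, μ k u)) := mul_le_mul_of_nonneg_right hd (by positivity)
    _ = t * ((univ.filter fun r : Fin m => (e r).1 = k ∨ (e r).2 = k).card : ℝ)
          * ((∑ u ∈ A, μ k u) * ∑ u ∈ Aᶜ, μ k u) := by field_simp

end Summit.Ventures.LatticeQCDFlow.Scaling

end
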